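import Summits.Ventures.CertifiedArithmetic.LowPrec.DoubleRoundingProductUnderflow
import Summits.Ventures.CertifiedArithmetic.LowPrec.DoubleRoundingProductGapTable

/-!
# Double rounding of products in the gap: the converse of the window law (no hit, no slip)

HONEST FRAMING (venture CertifiedArithmetic / cell `pub-lowprec`): certified error envelopes and
provably optimal rounding/accumulation schemes for low-precision formats under stated cost models;
every table by two implementations; no hardware or vendor claims.

`DoubleRoundingProductWindow.lean` proved the WINDOW LAW of the gap as a slip criterion and
`DoubleRoundingProductGapTable.lean` tabulated its integer form `mulWindowHit P t`.  This file
proves the CONVERSE for every pair of format records: in the gap `P + 1 ≤ d = L_φ - L_ψ ≤ 2P - 1`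
(`P = P_φ`, `t = 2P - d`), for an embedded source (`embedsTest`) with a normal binade
(`2^m ≤ M_φ`) and a register of precision `P_ψ ≥ 2P`: `mulWindowHit P t = false ⟹ DRMul φ ψ`.
Mechanism — TWO NESTED UNIFORM GRIDS (§1): a product of `φ`-data that is not a value of `ψ` is
`K·2^-u·q'` (`q' = quantum ψ`, `u ≥ 1`, `K = oa·ob < 2^(2P)` the product of the odd parts), hence
below `2^(t-1)·q ≤ 2^(P-2)·q` (`q = quantum φ = 2^d q'`): in the subnormal range of `φ`, where the
values of `φ` are ALL the multiples of `q` and those of `ψ` all the multiples of `q'`.  With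
`K = c·2^(d+u) + r`, `r < 2^(d+u)`, the product lies in the cell `[c q, (c+1) q]`; `fl_ψ` keeps it
on its side of the midpoint `(c + 1/2) q` (a value of `ψ`), where `fl_φ` is constant — unless
`fl_ψ` lands ON the midpoint (product within `q'/2` of it) and ties-to-even crosses the product
(`c` of the odd-side parity): the window `(c even ∧ 2^n < r ≤ 2^n + 2^(u-1)) ∨ (c odd ∧
2^n - 2^(u-1) ≤ r < 2^n)`, `n = d + u - 1`, of `mulWindowHitAt`, which also forces `u ≤ t`.

* §1 `window_of_roundNE_roundNE_ne` — pointwise, any `d ≥ 1`: a slip at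
  `x = (c·2^(d+u) + r)·2^-u·q'` forces the window (`c + 1` a low datum of `φ`, `(c+1)·2^d` of `ψ`).
* §2 `mulWindowHitAt_of_window`, `mulWindowHit_of_hitAt` — the window in the table's integers.
* §3 `drMul_of_mulWindowHit_eq_false` — THE CONVERSE on records (product normal form by odd parts;
  exact-in-`ψ` and saturated products aside; sign symmetry).

With the soundness half (`not_drMul_of_window_above/_below`) `DRMul` on the gap becomes a DECIDED
property of `(P, t)` for all deep roomy embedded pairs (`DoubleRoundingProductLaw.lean`).
Two implementations: A = `code/enum/mul_underflow_law.py`, `mul_window_law.py` (brute force of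
`DRMul` on pseudo-records `2 ≤ P ≤ 6` against `¬ hit(P, t)`, `0` mismatches) →
`certs/enum/DOUBLE-ROUNDING-MUL-{UNDERFLOW,WINDOWLAW}.json`; B = this file (kernel, every record).
PLACEMENT — KNOWN: innocuous double rounding when the first rounding is exact or
`p' ≥ 2p` (+ range) [Figueroa1995, §3], [Roux2014, Table II]; midpoint (slip) criteria
[Figueroa1995, §2], [BoldoMelquiond2008, §2], [MullerEtAl2018, §3.3.2]; precision-side thresholds
[Rump2016IEEETC].  We found no exponent-range (underflow-gap) decision for products in print
(searches: `DoubleRoundingProductUnderflow.lean`, FRESHNESS-ENUM.md gen22/23).  NEW here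
(modestly): the converse of the window law, record-generic.  No hardware or vendor claims.
-/

namespace Summit.Ventures.CertifiedArithmetic

open Literature.ComputerArithmetic.FloatingPoint
open Literature.ComputerArithmetic.FloatingPoint.Format
open Literature.ComputerArithmetic.FloatingPoint.MiniFloat

/-! ## §1 Two nested uniform grids: a slip forces the window -/

/-- SIGN SYMMETRY of double rounding: it suffices to treat `|x|`. [folklore] -/
theorem toRat_roundNE_roundNE_of_abs {φ ψ : Format} {x : ℚ}
    (h : (roundNE φ (roundNE ψ |x|).toRat).toRat = (roundNE φ |x|).toRat) :
    (roundNE φ (roundNE ψ x).toRat).toRat = (roundNE φ x).toRat := by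
  rcases le_or_gt 0 x with hx | hx
  · rwa [abs_of_nonneg hx] at h
  · rwa [abs_of_neg hx, toRat_roundNE_neg, toRat_roundNE_neg, toRat_roundNE_neg, neg_inj] at h

/-- THE WINDOW IS FORCED BY A SLIP (converse of the window law, pointwise; `q = quantum φ = 2^d q'`,
`q' = quantum ψ`, `d ≥ 1`, `m_φ ≥ 1`): for `x = (c·2^(d+u) + r)·2^-u·q'`, `u ≥ 1`, `r < 2^(d+u)`,
`c + 1` a low datum of `φ` and `(c+1)·2^d` one of `ψ`, a slip `fl_φ (fl_ψ x) ≠ fl_φ x` forces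
`(c even ∧ 2^n < r ≤ 2^n + 2^(u-1)) ∨ (c odd ∧ 2^n - 2^(u-1) ≤ r < 2^n)`, `n = d + u - 1` (`fl_ψ x`
stays on the side of the midpoint `(c + 1/2) q` where `fl_φ` is constant unless it IS the midpoint:
`x` within `q'/2` of it, crossed iff `c` has the odd-side parity). [this packet; Figueroa1995 §2] -/
theorem window_of_roundNE_roundNE_ne {φ ψ : Format} (hq : ψ.qexp + 1 ≤ φ.qexp)
    (h1 : 1 ≤ φ.manBits) {c r u : ℕ} (hu : 1 ≤ u) (hr : r < 2 ^ ((φ.qexp - ψ.qexp).toNat + u))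
    (hcm : c + 1 < 2 ^ (φ.manBits + 1)) (hcM : c + 1 ≤ φ.maxScaled)
    (hψm : (c + 1) * 2 ^ (φ.qexp - ψ.qexp).toNat < 2 ^ (ψ.manBits + 1))
    (hψM : (c + 1) * 2 ^ (φ.qexp - ψ.qexp).toNat ≤ ψ.maxScaled)
    (hne : (roundNE φ (roundNE ψ (((c * 2 ^ ((φ.qexp - ψ.qexp).toNat + u) + r : ℕ) : ℚ)
        * ψ.quantum / 2 ^ u)).toRat).toRat
      ≠ (roundNE φ (((c * 2 ^ ((φ.qexp - ψ.qexp).toNat + u) + r : ℕ) : ℚ)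
        * ψ.quantum / 2 ^ u)).toRat) :
    (c % 2 = 0 ∧ 2 ^ ((φ.qexp - ψ.qexp).toNat + u - 1) < r ∧
        r ≤ 2 ^ ((φ.qexp - ψ.qexp).toNat + u - 1) + 2 ^ (u - 1)) ∨
      (c % 2 = 1 ∧ 2 ^ ((φ.qexp - ψ.qexp).toNat + u - 1) - 2 ^ (u - 1) ≤ r ∧
        r < 2 ^ ((φ.qexp - ψ.qexp).toNat + u - 1)) := by
  have hq0 := φ.quantum_pos; have hq1 := ψ.quantum_pos
  have hQ : φ.quantum = 2 ^ (φ.qexp - ψ.qexp).toNat * ψ.quantum :=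
    quantum_eq_two_pow_mul (by omega)
  obtain ⟨d, hd'⟩ : ∃ d, (φ.qexp - ψ.qexp).toNat = d := ⟨_, rfl⟩
  rw [hd'] at hr hψm hψM hne hQ ⊢
  obtain ⟨n, hn⟩ : ∃ n, d + u - 1 = n := ⟨_, rfl⟩
  have hn1 : d + u = n + 1 := by omega
  rw [hn]; rw [hn1] at hr hne
  -- the unit `s = q' / 2^u`: `q' = 2^u s`, `q = 2·2^n s`, `x = c q + r s`
  set s : ℚ := ψ.quantum / 2 ^ u with hs
  have hs0 : 0 < s := by positivity
  have hq' : ψ.quantum = 2 ^ u * s := by rw [hs]; field_simp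
  have hpn : (2 : ℚ) ^ n = 2 ^ (d - 1) * 2 ^ u := by rw [← pow_add]; congr 1; omega
  have hQs : φ.quantum = 2 * 2 ^ n * s := by
    rw [hQ, hq', hpn, show (2 : ℚ) ^ d = 2 * 2 ^ (d - 1) by rw [← pow_succ']; congr 1; omega]
    ring
  have hu2 : (2 : ℚ) ^ u = 2 * 2 ^ (u - 1) := by rw [← pow_succ']; congr 1; omega
  set x : ℚ := ((c * 2 ^ (n + 1) + r : ℕ) : ℚ) * ψ.quantum / 2 ^ u with hx
  have hxs : x = (c : ℚ) * φ.quantum + (r : ℚ) * s := by rw [hx, hQs, hs]; push_cast; ring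
  have hrs0 : 0 ≤ (r : ℚ) * s := by positivity
  have hr_lt : (r : ℚ) < 2 * 2 ^ n := by
    have : (r : ℚ) < (2 : ℚ) ^ (n + 1) := by exact_mod_cast hr
    rw [pow_succ] at this; linarith
  have hrs_lt : (r : ℚ) * s < 2 * 2 ^ n * s := mul_lt_mul_of_pos_right hr_lt hs0
  -- the values in play: `c q`, `(c+1) q` in `φ` (hence in `ψ`), the midpoint `c q + 2^n s` in `ψ`
  have hrepc : φ.Representable c := representable_of_lt_pow (by omega) (by omega)
  have hrepc1 : φ.Representable (c + 1) := representable_of_lt_pow hcm hcM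
  have h2d : 2 ^ d = 2 * 2 ^ (d - 1) := by rw [← pow_succ']; congr 1; omega
  have hcd : c * 2 ^ d ≤ (c + 1) * 2 ^ d := Nat.mul_le_mul_right _ (Nat.le_succ c)
  have hψc : ψ.Representable (c * 2 ^ d) :=
    representable_of_lt_pow (lt_of_le_of_lt hcd hψm) (le_trans hcd hψM)
  have hmid_le : (2 * c + 1) * 2 ^ (d - 1) ≤ (c + 1) * 2 ^ d := by
    rw [h2d, show (c + 1) * (2 * 2 ^ (d - 1)) = (2 * c + 2) * 2 ^ (d - 1) by ring]
    exact Nat.mul_le_mul_right _ (by omega)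
  have hψmid : ψ.Representable ((2 * c + 1) * 2 ^ (d - 1)) :=
    representable_of_lt_pow (lt_of_le_of_lt hmid_le hψm) (le_trans hmid_le hψM)
  obtain ⟨zc, hzc⟩ := exists_toRat_eq_natMul hψc
  obtain ⟨zm, hzm⟩ := exists_toRat_eq_natMul hψmid
  obtain ⟨zc1, hzc1⟩ := exists_toRat_eq_natMul (representable_of_lt_pow hψm hψM)
  have hzc' : zc.toRat = (c : ℚ) * φ.quantum := by rw [hzc, hQ]; push_cast; ring
  have hzc1' : zc1.toRat = ((c : ℚ) + 1) * φ.quantum := by rw [hzc1, hQ]; push_cast; ring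
  have hzm' : zm.toRat = (c : ℚ) * φ.quantum + 2 ^ n * s := by
    rw [hzm, hq', hQs, hpn]; push_cast; ring
  -- `fl_ψ x` is within `q'/2 = 2^(u-1) s` of `x` (nearest value: the grid point of `ψ` next to `x`)
  have hdist : |x - (roundNE ψ x).toRat| ≤ 2 ^ (u - 1) * s := by
    obtain ⟨k, hk⟩ : ∃ k, r / 2 ^ u = k := ⟨_, rfl⟩
    obtain ⟨ρ, hρ'⟩ : ∃ ρ, r % 2 ^ u = ρ := ⟨_, rfl⟩
    have hρ : r = k * 2 ^ u + ρ := by rw [← hk, ← hρ']; exact (Nat.div_add_mod' r (2 ^ u)).symm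
    have hρlt : ρ < 2 ^ u := by rw [← hρ']; exact Nat.mod_lt _ (by positivity)
    have hk1 : k < 2 ^ d := by
      rw [← hk, Nat.div_lt_iff_lt_mul (by positivity), ← pow_add, hn1]; exact hr
    have hk2 : (c + 1) * 2 ^ d = c * 2 ^ d + 2 ^ d := by ring
    have hρq : (r : ℚ) = (k : ℚ) * 2 ^ u + ρ := by exact_mod_cast hρ
    rcases le_or_gt (ρ * 2) (2 ^ u) with hlo | hhi
    · -- round down to `(c 2^d + k) q'`
      obtain ⟨z, hz⟩ := exists_toRat_eq_natMul (representable_of_lt_pow (φ := ψ)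
        (n := c * 2 ^ d + k) (by omega) (by omega))
      refine le_trans (roundNE_nearest (φ := ψ) x z) ?_
      have e : x - z.toRat = (ρ : ℚ) * s := by
        rw [hxs, hz, hρq, hQ, hq']; push_cast; ring
      have : (ρ : ℚ) * 2 ≤ 2 ^ u := by exact_mod_cast hlo
      rw [e, abs_of_nonneg (by positivity)]; rw [hu2] at this
      exact mul_le_mul_of_nonneg_right (by linarith) hs0.le
    · -- round up to `(c 2^d + k + 1) q'`
      obtain ⟨z, hz⟩ := exists_toRat_eq_natMul (representable_of_lt_pow (φ := ψ)
        (n := c * 2 ^ d + k + 1) (by omega) (by omega))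
      refine le_trans (roundNE_nearest (φ := ψ) x z) ?_
      have e : x - z.toRat = -(((2 ^ u - ρ : ℕ) : ℚ) * s) := by
        rw [hxs, hz, hρq, hQ, hq', Nat.cast_sub hρlt.le]; push_cast; ring
      have : (((2 ^ u - ρ : ℕ)) : ℚ) * 2 ≤ 2 ^ u := by
        exact_mod_cast (by omega : (2 ^ u - ρ) * 2 ≤ 2 ^ u)
      rw [e, abs_neg, abs_of_nonneg (by positivity)]; rw [hu2] at this
      exact mul_le_mul_of_nonneg_right (by linarith) hs0.le
  -- `fl_φ` is constant on each half-cell; ties-to-even at the midpoint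
  have hmid_eq : ((2 * c + 1 : ℕ) : ℚ) / 2 * φ.quantum = (c : ℚ) * φ.quantum + 2 ^ n * s := by
    rw [hQs]; push_cast; ring
  have hlow : ∀ y : ℚ, (c : ℚ) * φ.quantum ≤ y → y < (c : ℚ) * φ.quantum + 2 ^ n * s →
      (roundNE φ y).toRat = (c : ℚ) * φ.quantum := by
    intro y hy1 hy2
    have := toRat_roundNE_natMul_add_small hrepc (ε := y - (c : ℚ) * φ.quantum)
      (by rw [abs_of_nonneg (by linarith)]; linarith)
    rwa [add_sub_cancel] at this
  have hhigh : ∀ y : ℚ, (c : ℚ) * φ.quantum + 2 ^ n * s < y → y ≤ ((c : ℚ) + 1) * φ.quantum →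
      (roundNE φ y).toRat = ((c : ℚ) + 1) * φ.quantum := by
    intro y hy1 hy2
    have := toRat_roundNE_natMul_add_small hrepc1 (ε := y - ((c : ℚ) + 1) * φ.quantum)
      (by rw [abs_of_nonpos (by linarith)]; linarith)
    push_cast at this; rwa [add_sub_cancel] at this
  -- case analysis on the position of `x` in its cell
  rcases lt_trichotomy r (2 ^ n) with hrn | hrn | hrn
  · -- below the midpoint: `fl_φ x = c q`, `fl_ψ x ∈ [c q, midpoint]`
    right
    have hrns : (r : ℚ) * s < 2 ^ n * s := mul_lt_mul_of_pos_right (by exact_mod_cast hrn) hs0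
    have hx1 : (c : ℚ) * φ.quantum ≤ x := by rw [hxs]; linarith
    have hx2 : x < (c : ℚ) * φ.quantum + 2 ^ n * s := by rw [hxs]; linarith
    have hfx : (roundNE φ x).toRat = (c : ℚ) * φ.quantum := hlow x hx1 hx2
    have hy1 : (c : ℚ) * φ.quantum ≤ (roundNE ψ x).toRat := by
      have := toRat_roundNE_mono (φ := ψ) hx1
      rwa [← hzc', toRat_roundNE_toRat, hzc'] at this
    have hy2 : (roundNE ψ x).toRat ≤ (c : ℚ) * φ.quantum + 2 ^ n * s := by
      have := toRat_roundNE_mono (φ := ψ) hx2.le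
      rwa [← hzm', toRat_roundNE_toRat, hzm'] at this
    rcases lt_or_eq_of_le hy2 with hlt | heq
    · exact absurd ((hlow _ hy1 hlt).trans hfx.symm) hne
    · -- on the midpoint: distance and parity
      have hd2 : ((2 : ℚ) ^ n - r) * s ≤ 2 ^ (u - 1) * s := by
        have := hdist
        rwa [heq, hxs, show (c : ℚ) * φ.quantum + (r : ℚ) * s - ((c : ℚ) * φ.quantum
          + 2 ^ n * s) = -((2 ^ n - r) * s) by ring, abs_neg,
          abs_of_nonneg (mul_nonneg (sub_nonneg.2 (by exact_mod_cast hrn.le)) hs0.le)] at this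
      have hd3 : (2 : ℚ) ^ n - r ≤ 2 ^ (u - 1) := le_of_mul_le_mul_right hd2 hs0
      have hd2' : 2 ^ n - 2 ^ (u - 1) ≤ r := by
        have h' : ((2 ^ n - 2 ^ (u - 1) : ℕ) : ℚ) ≤ r := by
          rw [Nat.cast_sub (Nat.pow_le_pow_right (by norm_num) (by omega))]; push_cast; linarith
        exact_mod_cast h'
      refine ⟨?_, hd2', hrn⟩
      by_contra hc
      have := toRat_roundNE_half_of_even h1 (Nat.even_iff.mpr (by omega)) hcm hcM
      rw [hmid_eq, ← heq] at this
      exact hne (this.trans hfx.symm)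
  · -- `x` is the midpoint itself, a value of `ψ`: no slip
    exact absurd (toRat_roundNE_roundNE_of_exists ⟨zm, by rw [hzm', hxs, hrn]; push_cast; ring⟩) hne
  · -- above the midpoint: `fl_φ x = (c+1) q`, `fl_ψ x ∈ [midpoint, (c+1) q]`
    left
    have hrns : (2 : ℚ) ^ n * s < (r : ℚ) * s := mul_lt_mul_of_pos_right (by exact_mod_cast hrn) hs0
    have hx1 : (c : ℚ) * φ.quantum + 2 ^ n * s < x := by rw [hxs]; linarith
    have hx2 : x ≤ ((c : ℚ) + 1) * φ.quantum := by rw [hxs]; linarith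
    have hfx : (roundNE φ x).toRat = ((c : ℚ) + 1) * φ.quantum := hhigh x hx1 hx2
    have hy1 : (c : ℚ) * φ.quantum + 2 ^ n * s ≤ (roundNE ψ x).toRat := by
      have := toRat_roundNE_mono (φ := ψ) hx1.le
      rwa [← hzm', toRat_roundNE_toRat, hzm'] at this
    have hy2 : (roundNE ψ x).toRat ≤ ((c : ℚ) + 1) * φ.quantum := by
      have := toRat_roundNE_mono (φ := ψ) hx2
      rwa [← hzc1', toRat_roundNE_toRat, hzc1'] at this
    rcases lt_or_eq_of_le hy1 with hlt | heq
    · exact absurd ((hhigh _ hlt hy2).trans hfx.symm) hne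
    · have hd2 : ((r : ℚ) - 2 ^ n) * s ≤ 2 ^ (u - 1) * s := by
        have := hdist
        rwa [← heq, hxs, show (c : ℚ) * φ.quantum + (r : ℚ) * s - ((c : ℚ) * φ.quantum
          + 2 ^ n * s) = (r - 2 ^ n) * s by ring,
          abs_of_nonneg (mul_nonneg (sub_nonneg.2 (by exact_mod_cast hrn.le)) hs0.le)] at this
      have hd3 : (r : ℚ) - 2 ^ n ≤ 2 ^ (u - 1) := le_of_mul_le_mul_right hd2 hs0
      have hd2' : r ≤ 2 ^ n + 2 ^ (u - 1) := by
        have h' : (r : ℚ) ≤ ((2 ^ n + 2 ^ (u - 1) : ℕ) : ℚ) := by push_cast; linarith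
        exact_mod_cast h'
      refine ⟨?_, hrn, hd2'⟩
      by_contra hc
      have := toRat_roundNE_half_of_odd h1 (Nat.odd_iff.mpr (by omega)) hcm hcM
      rw [hmid_eq, heq] at this; push_cast at this
      exact hne (this.trans hfx.symm)

/-! ## §2 The window in the integers of the table -/

/-- The window disjunction at `K = oa·ob = c·2^(n+1) + r`, `n = 2P - 1 - t + u`, is a hit of
`mulWindowHitAt P t u oa ob`. [this packet] -/
theorem mulWindowHitAt_of_window {P t u oa ob n c r : ℕ} (hn : 2 * P - 1 - t + u = n)
    (hK : oa * ob = c * 2 ^ (n + 1) + r) (hr : r < 2 ^ (n + 1))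
    (hw : (c % 2 = 0 ∧ 2 ^ n < r ∧ r ≤ 2 ^ n + 2 ^ (u - 1)) ∨
      (c % 2 = 1 ∧ 2 ^ n - 2 ^ (u - 1) ≤ r ∧ r < 2 ^ n)) :
    mulWindowHitAt P t u oa ob = true := by
  obtain ⟨hc, hr'⟩ := (Nat.div_mod_unique (a := oa * ob) (b := 2 ^ (n + 1)) (c := r) (d := c)
    (by positivity)).mpr ⟨by rw [hK]; ring, hr⟩
  simp only [mulWindowHitAt]
  rw [hn, hc, hr']
  simp only [Bool.or_eq_true, Bool.and_eq_true, beq_iff_eq, decide_eq_true_eq]; omega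

/-- A hit at some `1 ≤ u ≤ t` and odd `oa, ob < 2^P` is a hit of `mulWindowHit P t`. -/
theorem mulWindowHit_of_hitAt {P t u oa ob : ℕ} (hu : 1 ≤ u) (hut : u ≤ t)
    (hoa : oa % 2 = 1) (hoa' : oa < 2 ^ P) (hob : ob % 2 = 1) (hob' : ob < 2 ^ P)
    (h : mulWindowHitAt P t u oa ob = true) : mulWindowHit P t = true := by
  have hP : 2 ^ P = 2 * 2 ^ (P - 1) := by
    rcases P with _ | P
    · simp at hoa'; omega
    · rw [pow_succ']; rfl
  unfold mulWindowHit
  simp only [List.any_eq_true, List.mem_range]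
  refine ⟨u - 1, by omega, oa / 2, by omega, ob / 2, by omega, ?_⟩
  rwa [Nat.sub_add_cancel hu, show 2 * (oa / 2) + 1 = oa by omega,
    show 2 * (ob / 2) + 1 = ob by omega]

/-- RANGE OF THE CELL INDEX: `K < 2^(2m+2)`, `u ≥ 1`, `d ≤ 2m+1 ⟹ K / 2^(d+u) + 1 ≤ 2^(2m+1-d)`. -/
theorem div_two_pow_succ_le {K m d u : ℕ} (hK : K < 2 ^ (2 * m + 2)) (hu : 1 ≤ u)
    (hd : d ≤ 2 * m + 1) : K / 2 ^ (d + u) + 1 ≤ 2 ^ (2 * m + 1 - d) := by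
  have h1 : 2 ^ (2 * m + 2) = 2 ^ (2 * m + 1 - d) * (2 ^ d * 2) := by
    rw [← pow_succ, ← pow_add]; congr 1; omega
  have h2 : 2 ^ d * 2 ≤ 2 ^ (d + u) := by
    rw [pow_add]
    exact Nat.mul_le_mul_left _ (by simpa using Nat.pow_le_pow_right two_pos hu)
  have h3 : K / 2 ^ (d + u) * (2 ^ d * 2) ≤ K :=
    le_trans (Nat.mul_le_mul_left _ h2) (Nat.div_mul_le_self K _)
  have h4 : K / 2 ^ (d + u) * (2 ^ d * 2) < 2 ^ (2 * m + 1 - d) * (2 ^ d * 2) := by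
    rw [← h1]; exact lt_of_le_of_lt h3 hK
  exact Nat.lt_of_mul_lt_mul_right h4

/-! ## §3 The converse on records: no hit, no slip -/

/-- ODD PARTS: a nonzero datum is `o·2^j` quanta with `o` odd, `o < 2^(m+1)`. [folklore] -/
theorem exists_odd_mul_two_pow {φ : Format} (a : MiniFloat φ) (ha : a.scaledMag ≠ 0) :
    ∃ o j : ℕ, o % 2 = 1 ∧ o < 2 ^ (φ.manBits + 1) ∧ a.scaledMag = o * 2 ^ j := by
  obtain ⟨-, k, j, hk, hkj⟩ := representable_iff.mp a.representable_scaledMag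
  have hk0 : k ≠ 0 := by rintro rfl; simp at hkj; exact ha hkj
  obtain ⟨i, o, ho, hko⟩ := Nat.exists_eq_two_pow_mul_odd hk0
  refine ⟨o, i + j, Nat.odd_iff.mp ho, ?_, ?_⟩
  · have : o ≤ k := by rw [hko]; exact Nat.le_mul_of_pos_left o (by positivity)
    omega
  · rw [hkj, hko, pow_add]; ring

/-- THE CONVERSE OF THE WINDOW LAW — for EVERY pair of format records: `F_φ ⊆ F_ψ` (`embedsTest`),
`m = m_φ ≥ 1` with a normal binade (`2^m ≤ M_φ`), `2m + 1 ≤ m_ψ` (`P_ψ ≥ 2P_φ`), the gap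
`m + 2 ≤ d = L_φ - L_ψ ≤ 2m + 1` (`P + 1 ≤ d ≤ 2P - 1`, `t = 2P - d`) and NO hit
`mulWindowHit (m+1) t = false` `⟹ DRMul φ ψ`.  A product is saturated, or a value of `ψ` (odd
parts `K = oa·ob < 2^(2P) ≤ 2^P_ψ` at a nonnegative exponent of `q'`, below `maxRat φ ≤ maxRat ψ`),
or `K·2^-u·q'`, `u ≥ 1`, where §1 applies with `c = K / 2^(d+u) < 2^(2m+1-d) ≤ 2^(m-1)` and turns a
slip into a hit with `u ≤ t`. [this packet] -/
theorem drMul_of_mulWindowHit_eq_false {φ ψ : Format} (hE : embedsTest φ ψ = true)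
    (h1 : 1 ≤ φ.manBits) (hN : 2 ^ φ.manBits ≤ φ.maxScaled) (hm : 2 * φ.manBits + 1 ≤ ψ.manBits)
    (hlo : ψ.qexp + (φ.manBits + 2) ≤ φ.qexp) (hhi : φ.qexp ≤ ψ.qexp + (2 * φ.manBits + 1))
    (hhit : mulWindowHit (φ.manBits + 1) (2 * φ.manBits + 2 - (φ.qexp - ψ.qexp).toNat) = false) :
    DRMul φ ψ := by
  have htop := exists_toRat_eq_maxRat_of_test hE
  simp only [embedsTest, Bool.and_eq_true, decide_eq_true_eq] at hE
  obtain ⟨⟨-, hq⟩, hMM⟩ := hE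
  have hmax := (maxRat_le_maxRat_iff hq).2 hMM
  obtain ⟨d, hd'⟩ : ∃ d, (φ.qexp - ψ.qexp).toNat = d := ⟨_, rfl⟩
  rw [hd'] at hhit hMM
  have hdhi : d ≤ 2 * φ.manBits + 1 := by omega
  have hpow : 2 ^ (φ.manBits + 1) = 2 * 2 ^ φ.manBits := pow_succ' 2 _
  have hpm1 : 2 ^ (φ.manBits - 1) * 2 = 2 ^ φ.manBits := by rw [← pow_succ]; congr 1; omega
  -- the register holds `2^(2m+2)` quanta: `M_ψ ≥ M_φ·2^d ≥ 2^m·2^(m+2)`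
  have hMψ : 2 ^ (2 * φ.manBits + 2) ≤ ψ.maxScaled := by
    refine le_trans ?_ hMM
    calc 2 ^ (2 * φ.manBits + 2) = 2 ^ φ.manBits * 2 ^ (φ.manBits + 2) := by
          rw [← pow_add]; congr 1; omega
      _ ≤ φ.maxScaled * 2 ^ d := Nat.mul_le_mul hN (Nat.pow_le_pow_right (by norm_num) (by omega))
  intro a b
  rcases le_or_gt φ.maxRat |a.toRat * b.toRat| with hsat | hlt
  · exact toRat_roundNE_roundNE_of_maxRat_le_abs htop hsat
  have habs := abs_toRat_mul_toRat a b
  by_cases h0 : a.scaledMag * b.scaledMag = 0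
  · have hx0 : a.toRat * b.toRat = 0 := abs_eq_zero.mp (by rw [habs, h0]; simp)
    rw [hx0]; exact toRat_roundNE_roundNE_of_exists ⟨zero ψ, toRat_zero⟩
  obtain ⟨ha0, hb0⟩ := mul_ne_zero_iff.mp h0
  obtain ⟨oa, ja, hoa, hoa', hsa⟩ := exists_odd_mul_two_pow a ha0
  obtain ⟨ob, jb, hob, hob', hsb⟩ := exists_odd_mul_two_pow b hb0
  have hK2 : oa * ob < 2 ^ (2 * φ.manBits + 2) := by
    calc oa * ob < 2 ^ (φ.manBits + 1) * 2 ^ (φ.manBits + 1) :=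
          Nat.mul_lt_mul_of_lt_of_le hoa' hob'.le (by positivity)
      _ = 2 ^ (2 * φ.manBits + 2) := by rw [← pow_add]; congr 1; omega
  have hKψ : oa * ob < 2 ^ (ψ.manBits + 1) :=
    lt_of_lt_of_le hK2 (Nat.pow_le_pow_right (by norm_num) (by omega))
  -- `|a·b| = K · 2^E · q'`, `K = oa·ob`, `E = ja + jb + 2 L_φ - L_ψ`
  obtain ⟨E, hE_def⟩ : ∃ E : ℤ, ((ja + jb : ℕ) : ℤ) + 2 * φ.qexp - ψ.qexp = E := ⟨_, rfl⟩
  have h2E : (2 : ℚ) ^ E * 2 ^ ψ.qexp = (2 : ℚ) ^ (ja + jb) * 2 ^ (φ.qexp + φ.qexp) := by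
    rw [← zpow_natCast, ← zpow_add₀ two_ne_zero, ← zpow_add₀ two_ne_zero]
    congr 1; push_cast; omega
  have habs' : |a.toRat * b.toRat| = ((oa * ob : ℕ) : ℚ) * (2 : ℚ) ^ E * ψ.quantum := by
    rw [habs, hsa, hsb]; unfold Format.quantum
    rw [mul_assoc (((oa * ob : ℕ)) : ℚ), h2E]; push_cast; ring
  rcases le_or_gt 0 E with hE0 | hE0
  · -- exact in `ψ`
    have hxE : |a.toRat * b.toRat| = ((oa * ob * 2 ^ E.toNat : ℕ) : ℚ) * ψ.quantum := by
      rw [habs']; push_cast; rw [← zpow_natCast, Int.toNat_of_nonneg hE0]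
    refine toRat_roundNE_roundNE_of_exists
      (exists_toRat_eq_of_abs_eq_natMul (representable_mul_pow hKψ ?_) hxE)
    have h' : ((oa * ob * 2 ^ E.toNat : ℕ) : ℚ) * ψ.quantum < (ψ.maxScaled : ℚ) * ψ.quantum := by
      rw [← hxE]; exact lt_of_lt_of_le hlt hmax
    exact_mod_cast (lt_of_mul_lt_mul_right h' ψ.quantum_pos.le).le
  -- `u ≥ 1`: the two-grid analysis
  obtain ⟨u, hu'⟩ : ∃ u : ℕ, (-E).toNat = u := ⟨_, rfl⟩
  obtain ⟨hu, hEu⟩ : 1 ≤ u ∧ E = -(u : ℤ) := ⟨by omega, by omega⟩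
  have hxu : |a.toRat * b.toRat| = ((oa * ob : ℕ) : ℚ) * ψ.quantum / 2 ^ u := by
    rw [habs', hEu, zpow_neg, zpow_natCast]; ring
  obtain ⟨c, hc'⟩ : ∃ c, oa * ob / 2 ^ (d + u) = c := ⟨_, rfl⟩
  obtain ⟨r, hr'⟩ : ∃ r, oa * ob % 2 ^ (d + u) = r := ⟨_, rfl⟩
  obtain ⟨hKcr, hrK⟩ := (Nat.div_mod_unique (a := oa * ob) (b := 2 ^ (d + u)) (c := r) (d := c)
    (by positivity)).mp ⟨hc', hr'⟩
  have hKcr' : oa * ob = c * 2 ^ (d + u) + r := by rw [← hKcr]; ring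
  have hc1 : c + 1 ≤ 2 ^ (2 * φ.manBits + 1 - d) := hc' ▸ div_two_pow_succ_le hK2 hu hdhi
  have hcm1 : 2 ^ (2 * φ.manBits + 1 - d) ≤ 2 ^ (φ.manBits - 1) :=
    Nat.pow_le_pow_right (by norm_num) (by omega)
  obtain ⟨hcm, hcM⟩ : c + 1 < 2 ^ (φ.manBits + 1) ∧ c + 1 ≤ φ.maxScaled := ⟨by omega, by omega⟩
  have hcd : (c + 1) * 2 ^ d ≤ 2 ^ (2 * φ.manBits + 1) := by
    calc (c + 1) * 2 ^ d ≤ 2 ^ (2 * φ.manBits + 1 - d) * 2 ^ d := Nat.mul_le_mul_right _ hc1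
      _ = 2 ^ (2 * φ.manBits + 1) := by rw [← pow_add]; congr 1; omega
  have h2m : 2 ^ (2 * φ.manBits + 1) < 2 ^ (2 * φ.manBits + 2) :=
    Nat.pow_lt_pow_right (by norm_num) (by omega)
  have hψm : (c + 1) * 2 ^ d < 2 ^ (ψ.manBits + 1) :=
    lt_of_le_of_lt hcd (lt_of_lt_of_le h2m (Nat.pow_le_pow_right (by norm_num) (by omega)))
  have hψM : (c + 1) * 2 ^ d ≤ ψ.maxScaled := by omega
  by_contra hne
  have hne' : (roundNE φ (roundNE ψ |a.toRat * b.toRat|).toRat).toRat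
      ≠ (roundNE φ |a.toRat * b.toRat|).toRat :=
    fun h => hne (toRat_roundNE_roundNE_of_abs h)
  rw [hxu, hKcr'] at hne'
  have hw := window_of_roundNE_roundNE_ne (ψ := ψ) (by omega) h1 hu (by rw [hd']; exact hrK)
    hcm hcM (by rw [hd']; exact hψm) (by rw [hd']; exact hψM) (by rw [hd']; exact hne')
  rw [hd'] at hw
  -- the window forces `u ≤ t`, and is a hit of the table
  have hrle : r ≤ oa * ob := by rw [hKcr']; omega
  have hut : u ≤ 2 * φ.manBits + 2 - d := by
    rcases hw with ⟨-, h2, -⟩ | ⟨h3, -, -⟩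
    · have h5 : 2 ^ (d + u - 1) < 2 ^ (2 * φ.manBits + 2) := by omega
      have := (Nat.pow_lt_pow_iff_right (by norm_num)).mp h5
      omega
    · have h4 : 2 ^ (d + u) ≤ oa * ob := by
        rw [hKcr']
        calc 2 ^ (d + u) = 1 * 2 ^ (d + u) := (one_mul _).symm
          _ ≤ c * 2 ^ (d + u) := Nat.mul_le_mul_right _ (by omega)
          _ ≤ c * 2 ^ (d + u) + r := Nat.le_add_right _ _
      have := (Nat.pow_lt_pow_iff_right (by norm_num)).mp (lt_of_le_of_lt h4 hK2)
      omega
  have hAt : mulWindowHitAt (φ.manBits + 1) (2 * φ.manBits + 2 - d) u oa ob = true :=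
    mulWindowHitAt_of_window (n := d + u - 1) (by omega)
      (by rw [show d + u - 1 + 1 = d + u by omega]; exact hKcr')
      (by rw [show d + u - 1 + 1 = d + u by omega]; exact hrK) hw
  have := mulWindowHit_of_hitAt hu hut hoa (by simpa using hoa') hob (by simpa using hob') hAt
  rw [hhit] at this; exact Bool.false_ne_true this

end Summit.Ventures.CertifiedArithmetic
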